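import Mathlib
import Literature.MathematicalPhysics.StatisticalMechanics.Crystallization
import Literature.MathematicalPhysics.StatisticalMechanics.LennardJonesClusters
import Summits.AtomisticToContinuum.Crystallization.Theses.ThreeConeCertificate
import Summits.AtomisticToContinuum.Crystallization.Theorems.ThreeConeCertificateExactCertificateTransfer1DSlack
import Summits.AtomisticToContinuum.Crystallization.Theorems.ThreeConeCertificateExactCertificateTransfer1DClassMie
import Summits.AtomisticToContinuum.Crystallization.Theorems.ThreeConeCertificateExactCertificateTransfer1DUniqueBlock
import Summits.AtomisticToContinuum.Crystallization.Theorems.ThreeConeCertificateExactCertificateTransfer1DUniqueBlockEnergy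
import Summits.AtomisticToContinuum.Crystallization.Theorems.ThreeConeCertificateExactCertificateTransfer1DUniqueCovariance
import Summits.AtomisticToContinuum.Crystallization.Theorems.ThreeConeCertificateExactCertificateTransfer1DUniqueCongruence
import Summits.AtomisticToContinuum.Crystallization.Theorems.ThreeConeCertificateExactCertificateTransfer1DUniqueIsometryChain

/-!
# Crux `ExactCertificate` (stmt-AtomisticToContinuum-11959), line `closure-makes-nogap-exact`, lead c9:
# TRANSFER skeleton VI — UNIQUENESS OF THE PERIODIC GROUND STATE OF THE LENNARD-JONES CHAIN (`UniquePeriodicMinimiser1D`)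

Skeleton VI v2 (c9, 2026-08-17) — SORRY-FREE: all five registered stubs LANDED in wave 2 (stub_block1D p157383, stub_blockEnergy1D p157282, stub_badOfBadSite1D p157135, stub_exactOfGood1D p157163, stub_isometryChain1D p157203) and are IMPORTED below; the assembly `…Transfer1DUnique.lean` (registered `stub_uniqueAssembly`) is a separate tree file.  v1:  The 3-D line is parked (skeleton v6: `stub_noGap`, `stub_periodicMinimum` = KeplerBound =
11961 ↔ 0627, item-level; nothing below is a stub of the 3-D crux).  After Transfer I–V (certificate, energetic and positional
crystallization, slack rigidity, the class theorem) the d = 1 twin of the route's UNIQUENESS question (SlackRigidity's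
`why_might_fail`: "needs a unique periodic minimiser up to isometry"; in d = 3 the tree theorems
`ThreeConeCertificateSlackRigidityPinsMinimisers` / `…LawPalmSplit` derive it FROM the crux) is proved UNCONDITIONALLY:

  `UniquePeriodicMinimiser1D` := there is `a > 0` (the zero-pressure spacing) such that some periodic configuration with
  point set `{(ka)e₀ : k ∈ ℤ}` minimises the Lennard-Jones energy per particle over all periodic configurations of `ℝ¹`, and
  EVERY periodic minimiser `Q` is a translate of it: `Q.points = {q + (ka)e₀ : k ∈ ℤ}` for each `q ∈ Q.points`.

Mechanism (the route's, as in 3-D `PinsMinimisers`, but with every input a d = 1 theorem): c8's RATE form of slack rigidity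
(`slackRigidityRate_lennardJones_one`: `#bad ≤ A + B·(E(x) − E(N))` for a hidden template `P`), tested on the BLOCKS of a
periodic minimiser `Q` (`#F·K` points `y + jv`; energy `= #F K e(Q) + o(K)` by Cesàro, `stub_blockEnergy1D`; `E(N) ≥ N e(Q)` by the
Kepler bound of Transfer V at the explicit chain): a `Q`-bad site would make `K − D` deep block points bad (`stub_block1D`,
`stub_badOfBadSite1D`), contradicting the O(1)+o(K) bound; so every site of `Q` is matched to `P` at every scale, hence EXACTLY
`Q.points = q + A(P.points)` (`stub_exactOfGood1D`, local finiteness, isometries of the line are `±1`); running the same argument on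
the explicit chain identifies `P.points = aℤe₀` up to sign, whence the claim.
-/

noncomputable section

/-! ## The stubs — ALL LANDED (imported; namespace `…Theorems.ThreeConeCertificateExactCertificate.Transfer1D`):
`stub_block1D` (W1a, p157383), `stub_blockEnergy1D` (W1b, p157282), `stub_badOfBadSite1D` (W2, p157135), `stub_exactOfGood1D`
(W3, p157163), `stub_isometryChain1D` (W5, p157203). -/

namespace Summit.AtomisticToContinuum.Crystallization.Cruxes.ExactCertificate.Transfer1D

open Literature.MathematicalPhysics.StatisticalMechanics MeasureTheory Set Filter Topology
open scoped BigOperators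
open Summit.AtomisticToContinuum.Crystallization.Theorems.ThreeConeCertificateExactCertificate.Transfer1D

/-- **The deciding statement of Transfer skeleton VI: UNIQUENESS OF THE PERIODIC GROUND STATE OF THE LENNARD-JONES CHAIN.**
There is `a > 0` such that (i) a periodic configuration of `ℝ¹` with point set `{(ka)e₀ : k ∈ ℤ}` minimises the Lennard-Jones
energy per particle over all periodic configurations of the line, and (ii) EVERY periodic minimiser `Q` is a translate of it:
`Q.points = {q + (ka)e₀ : k ∈ ℤ}` for each of its points `q`. -/
def UniquePeriodicMinimiser1D : Prop :=
  ∃ a : ℝ, 0 < a ∧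
    (∃ P₀ : PeriodicConfiguration 1,
      P₀.points = Set.range (fun k : ℤ => EuclideanSpace.single (0 : Fin 1) ((k : ℝ) * a)) ∧
      ∀ Q : PeriodicConfiguration 1, P₀.energyPerParticle lennardJones ≤ Q.energyPerParticle lennardJones) ∧
    ∀ Q : PeriodicConfiguration 1,
      (∀ Q' : PeriodicConfiguration 1, Q.energyPerParticle lennardJones ≤ Q'.energyPerParticle lennardJones) →
      ∀ q ∈ Q.points, Q.points = Set.range (fun k : ℤ => q + EuclideanSpace.single (0 : Fin 1) ((k : ℝ) * a))

/-! ## Composition: the stubs close `UniquePeriodicMinimiser1D` -/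

/-- **UNIQUENESS OF THE PERIODIC LENNARD-JONES GROUND STATE OF THE LINE**: composition of the registered stubs with c8's rate
theorem `slackRigidityRate_lennardJones_one` and Transfer V's explicit chain (`mie_oneCrossingData`, `oneCrossing_magic`,
`energyPerParticle_ge_of_oneCrossing`, `keplerBound_one_of_oneCrossing`, `stub_latticeGenerator1D`). -/
theorem UniquePeriodicMinimiser1D_of : UniquePeriodicMinimiser1D := by
  -- (0) the explicit zero-pressure chain of Transfer V (Lennard-Jones = Mie (12,6))
  have hLJ : Literature.Barriers.AtomisticToContinuum.mieWith (1 / 12) (1 / 6) 12 6 = lennardJones :=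
    (Literature.Barriers.AtomisticToContinuum.lennardJones_eq_lennardJonesWith.trans
      (Literature.Barriers.AtomisticToContinuum.lennardJonesWith_eq_mieWith _ _)).symm
  obtain ⟨p, t₀, C, a, M, hpm, ht₀, hpos, hneg, hM, hbd, hV, ha, hz⟩ :=
    mie_oneCrossingData (A := 1 / 12) (B := 1 / 6) (n := 12) (m := 6)
      (by norm_num) (by norm_num) (by norm_num) (by norm_num)
  rw [hLJ] at hV
  obtain ⟨f, Pa, e, he, hPa, -, -, -, -⟩ := oneCrossing_magic hpm ht₀ hpos hneg hM hbd hV ha hz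
  have hmin : ∀ Q : PeriodicConfiguration 1,
      Pa.energyPerParticle lennardJones ≤ Q.energyPerParticle lennardJones :=
    fun Q => hPa ▸ energyPerParticle_ge_of_oneCrossing hpm ht₀ hpos hneg hM hbd hV ha hz Q
  have hkep : ∀ (N : ℕ) (x : Fin N → EuclideanSpace ℝ (Fin 1)), Function.Injective x →
      (N : ℝ) * Pa.energyPerParticle lennardJones ≤ interactionEnergy lennardJones x :=
    fun N x hx => hPa ▸ keplerBound_one_of_oneCrossing hpm ht₀ hpos hneg hM hbd hV ha hz N x hx
  have hPapts : Pa.points = Set.range (fun k : ℤ => EuclideanSpace.single (0 : Fin 1) ((k : ℝ) * a)) := by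
    ext z
    constructor
    · intro hz'
      obtain ⟨k, hk⟩ := e.surjective ⟨z, hz'⟩
      refine ⟨k, ?_⟩
      show EuclideanSpace.single (0 : Fin 1) ((k : ℝ) * a) = z
      rw [← he k, hk]
    · rintro ⟨k, rfl⟩
      show EuclideanSpace.single (0 : Fin 1) ((k : ℝ) * a) ∈ Pa.points
      rw [← he k]
      exact (e k).2
  -- (1) the rate theorem's (hidden) template `Pr`
  obtain ⟨Pr, hPr⟩ := slackRigidityRate_lennardJones_one
  -- (2) KEY: every site of every periodic minimiser is two-way matched to `Pr` at every scale
  have key : ∀ Q : PeriodicConfiguration 1,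
      (∀ Q' : PeriodicConfiguration 1, Q.energyPerParticle lennardJones ≤ Q'.energyPerParticle lennardJones) →
      ∀ q₀ ∈ Q.points, ∀ R ε : ℝ, 0 < R → 0 < ε →
      ∃ A : EuclideanSpace ℝ (Fin 1) →ₗᵢ[ℝ] EuclideanSpace ℝ (Fin 1),
        (∀ p ∈ Pr.points, ‖p‖ ≤ R → ∃ z ∈ Q.points, dist z (q₀ + A p) ≤ ε) ∧
        (∀ z ∈ Q.points, dist z q₀ ≤ R → ∃ p ∈ Pr.points, dist z (q₀ + A p) ≤ ε) := by
    intro Q hQ q₀ hq₀ R ε hR hε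
    by_contra hbad
    obtain ⟨v, -, hv⟩ := stub_latticeGenerator1D Q
    obtain ⟨hinj, hmem, hdeep⟩ := stub_block1D Q v hv
    obtain ⟨D, hD⟩ := hdeep R hR
    have hEt := stub_blockEnergy1D Q v hv
    obtain ⟨A, B, hA0, hB0, hrate⟩ := hPr R ε hR hε
    have heq : Q.energyPerParticle lennardJones = Pa.energyPerParticle lennardJones :=
      le_antisymm (hQ Pa) (hmin Q)
    -- for every `K`: `K − D ≤ A + B·s_K`, `s_K` the block's energy excess over `N e(Q)`
    have hK : ∀ K : ℕ, (K : ℝ) - D ≤ A + B *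
        (interactionEnergy lennardJones (fun i : Fin (Q.motif.card * K) => (((Q.motif.equivFin.symm (finProdFinEquiv.symm i).1 : Q.motif) : EuclideanSpace ℝ (Fin 1)) + (((finProdFinEquiv.symm i).2 : ℕ) : ℝ) • v))
          - ((Q.motif.card * K : ℕ) : ℝ) * Q.energyPerParticle lennardJones) := by
      intro K
      have h1 := hD K q₀ hq₀
      have h2 := hrate (Q.motif.card * K) (fun i : Fin (Q.motif.card * K) => (((Q.motif.equivFin.symm (finProdFinEquiv.symm i).1 : Q.motif) : EuclideanSpace ℝ (Fin 1)) + (((finProdFinEquiv.symm i).2 : ℕ) : ℝ) • v)) (hinj K)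
      -- deep & congruent ⟹ bad
      have h3 : Nat.card {i : Fin (Q.motif.card * K) //
            (((Q.motif.equivFin.symm (finProdFinEquiv.symm i).1 : Q.motif) : EuclideanSpace ℝ (Fin 1)) + (((finProdFinEquiv.symm i).2 : ℕ) : ℝ) • v) - q₀ ∈ Q.lattice ∧
            ∀ z ∈ Q.points, dist z ((((Q.motif.equivFin.symm (finProdFinEquiv.symm i).1 : Q.motif) : EuclideanSpace ℝ (Fin 1)) + (((finProdFinEquiv.symm i).2 : ℕ) : ℝ) • v)) ≤ R →
              ∃ j : Fin (Q.motif.card * K), (((Q.motif.equivFin.symm (finProdFinEquiv.symm j).1 : Q.motif) : EuclideanSpace ℝ (Fin 1)) + (((finProdFinEquiv.symm j).2 : ℕ) : ℝ) • v) = z} ≤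
          Nat.card {i : Fin (Q.motif.card * K) // ¬ ∃ A : EuclideanSpace ℝ (Fin 1) →ₗᵢ[ℝ] EuclideanSpace ℝ (Fin 1),
            (∀ p ∈ Pr.points, ‖p‖ ≤ R → ∃ j : Fin (Q.motif.card * K),
              dist ((fun i : Fin (Q.motif.card * K) => (((Q.motif.equivFin.symm (finProdFinEquiv.symm i).1 : Q.motif) : EuclideanSpace ℝ (Fin 1)) + (((finProdFinEquiv.symm i).2 : ℕ) : ℝ) • v)) j)
                ((fun i : Fin (Q.motif.card * K) => (((Q.motif.equivFin.symm (finProdFinEquiv.symm i).1 : Q.motif) : EuclideanSpace ℝ (Fin 1)) + (((finProdFinEquiv.symm i).2 : ℕ) : ℝ) • v)) i + A p) ≤ ε) ∧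
            (∀ j : Fin (Q.motif.card * K),
              dist ((fun i : Fin (Q.motif.card * K) => (((Q.motif.equivFin.symm (finProdFinEquiv.symm i).1 : Q.motif) : EuclideanSpace ℝ (Fin 1)) + (((finProdFinEquiv.symm i).2 : ℕ) : ℝ) • v)) j)
                ((fun i : Fin (Q.motif.card * K) => (((Q.motif.equivFin.symm (finProdFinEquiv.symm i).1 : Q.motif) : EuclideanSpace ℝ (Fin 1)) + (((finProdFinEquiv.symm i).2 : ℕ) : ℝ) • v)) i) ≤ R →
              ∃ p ∈ Pr.points, dist ((fun i : Fin (Q.motif.card * K) => (((Q.motif.equivFin.symm (finProdFinEquiv.symm i).1 : Q.motif) : EuclideanSpace ℝ (Fin 1)) + (((finProdFinEquiv.symm i).2 : ℕ) : ℝ) • v)) j)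
                ((fun i : Fin (Q.motif.card * K) => (((Q.motif.equivFin.symm (finProdFinEquiv.symm i).1 : Q.motif) : EuclideanSpace ℝ (Fin 1)) + (((finProdFinEquiv.symm i).2 : ℕ) : ℝ) • v)) i + A p) ≤ ε)} := by
        refine Nat.card_le_card_of_injective
          (fun u => ⟨u.1, stub_badOfBadSite1D Pr Q R ε (Q.motif.card * K)
            (fun i : Fin (Q.motif.card * K) => (((Q.motif.equivFin.symm (finProdFinEquiv.symm i).1 : Q.motif) : EuclideanSpace ℝ (Fin 1)) + (((finProdFinEquiv.symm i).2 : ℕ) : ℝ) • v)) (hmem K) q₀ hq₀ hbad u.1 u.2⟩) ?_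
        intro u u' h
        simp only [Subtype.mk.injEq] at h
        exact Subtype.ext h
      -- `E(N) ≥ N e(Q)` (Kepler at the explicit chain, `e(Q) = e(Pa)`)
      have h4 : ((Q.motif.card * K : ℕ) : ℝ) * Q.energyPerParticle lennardJones ≤
          groundStateEnergy lennardJones 1 (Q.motif.card * K) := by
        rw [heq]
        haveI : Nonempty {x : Fin (Q.motif.card * K) → EuclideanSpace ℝ (Fin 1) // Function.Injective x} := ⟨⟨_, hinj K⟩⟩
        exact le_ciInf fun y => hkep _ y.1 y.2
      have h3' : (Nat.card {i : Fin (Q.motif.card * K) //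
            (((Q.motif.equivFin.symm (finProdFinEquiv.symm i).1 : Q.motif) : EuclideanSpace ℝ (Fin 1)) + (((finProdFinEquiv.symm i).2 : ℕ) : ℝ) • v) - q₀ ∈ Q.lattice ∧
            ∀ z ∈ Q.points, dist z ((((Q.motif.equivFin.symm (finProdFinEquiv.symm i).1 : Q.motif) : EuclideanSpace ℝ (Fin 1)) + (((finProdFinEquiv.symm i).2 : ℕ) : ℝ) • v)) ≤ R →
              ∃ j : Fin (Q.motif.card * K), (((Q.motif.equivFin.symm (finProdFinEquiv.symm j).1 : Q.motif) : EuclideanSpace ℝ (Fin 1)) + (((finProdFinEquiv.symm j).2 : ℕ) : ℝ) • v) = z} : ℝ) ≤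
          Nat.card {i : Fin (Q.motif.card * K) // ¬ ∃ A : EuclideanSpace ℝ (Fin 1) →ₗᵢ[ℝ] EuclideanSpace ℝ (Fin 1),
            (∀ p ∈ Pr.points, ‖p‖ ≤ R → ∃ j : Fin (Q.motif.card * K),
              dist ((fun i : Fin (Q.motif.card * K) => (((Q.motif.equivFin.symm (finProdFinEquiv.symm i).1 : Q.motif) : EuclideanSpace ℝ (Fin 1)) + (((finProdFinEquiv.symm i).2 : ℕ) : ℝ) • v)) j)
                ((fun i : Fin (Q.motif.card * K) => (((Q.motif.equivFin.symm (finProdFinEquiv.symm i).1 : Q.motif) : EuclideanSpace ℝ (Fin 1)) + (((finProdFinEquiv.symm i).2 : ℕ) : ℝ) • v)) i + A p) ≤ ε) ∧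
            (∀ j : Fin (Q.motif.card * K),
              dist ((fun i : Fin (Q.motif.card * K) => (((Q.motif.equivFin.symm (finProdFinEquiv.symm i).1 : Q.motif) : EuclideanSpace ℝ (Fin 1)) + (((finProdFinEquiv.symm i).2 : ℕ) : ℝ) • v)) j)
                ((fun i : Fin (Q.motif.card * K) => (((Q.motif.equivFin.symm (finProdFinEquiv.symm i).1 : Q.motif) : EuclideanSpace ℝ (Fin 1)) + (((finProdFinEquiv.symm i).2 : ℕ) : ℝ) • v)) i) ≤ R →
              ∃ p ∈ Pr.points, dist ((fun i : Fin (Q.motif.card * K) => (((Q.motif.equivFin.symm (finProdFinEquiv.symm i).1 : Q.motif) : EuclideanSpace ℝ (Fin 1)) + (((finProdFinEquiv.symm i).2 : ℕ) : ℝ) • v)) j)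
                ((fun i : Fin (Q.motif.card * K) => (((Q.motif.equivFin.symm (finProdFinEquiv.symm i).1 : Q.motif) : EuclideanSpace ℝ (Fin 1)) + (((finProdFinEquiv.symm i).2 : ℕ) : ℝ) • v)) i + A p) ≤ ε)} := by
        exact_mod_cast h3
      nlinarith [h1, h2, h3', h4, hB0]
    -- the limit `K → ∞`: `s_K = o(K)` contradicts `K − D ≤ A + B s_K`
    have hBpos : (0 : ℝ) < 2 * (B + 1) := by positivity
    have hev := hEt.eventually (Metric.ball_mem_nhds (0 : ℝ) (show (0 : ℝ) < 1 / (2 * (B + 1)) by positivity))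
    obtain ⟨K, hK1, hK2⟩ := (hev.and (eventually_ge_atTop (⌈2 * (A + D) + 2⌉₊ + 1))).exists
    have hKpos : (0 : ℝ) < K := by
      have : (1 : ℕ) ≤ K := le_trans (Nat.le_add_left 1 _) hK2
      exact_mod_cast this
    have hKge : 2 * (A + D) + 2 ≤ (K : ℝ) := by
      have h := Nat.le_ceil (2 * (A + D) + 2)
      have h' : ((⌈2 * (A + D) + 2⌉₊ + 1 : ℕ) : ℝ) ≤ K := by exact_mod_cast hK2
      push_cast at h'
      linarith
    rw [dist_zero_right, Real.norm_eq_abs, abs_lt] at hK1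
    have hs := hK1.2
    rw [div_lt_iff₀ hKpos] at hs
    have hKK := hK K
    -- `B s_K ≤ B K/(2(B+1)) ≤ K/2`
    have hBs : B * (interactionEnergy lennardJones (fun i : Fin (Q.motif.card * K) => (((Q.motif.equivFin.symm (finProdFinEquiv.symm i).1 : Q.motif) : EuclideanSpace ℝ (Fin 1)) + (((finProdFinEquiv.symm i).2 : ℕ) : ℝ) • v))
          - ((Q.motif.card * K : ℕ) : ℝ) * Q.energyPerParticle lennardJones) ≤ K / 2 := by
      have h1 : B * (interactionEnergy lennardJones (fun i : Fin (Q.motif.card * K) => (((Q.motif.equivFin.symm (finProdFinEquiv.symm i).1 : Q.motif) : EuclideanSpace ℝ (Fin 1)) + (((finProdFinEquiv.symm i).2 : ℕ) : ℝ) • v))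
          - ((Q.motif.card * K : ℕ) : ℝ) * Q.energyPerParticle lennardJones) ≤ B * (1 / (2 * (B + 1)) * K) :=
        mul_le_mul_of_nonneg_left hs.le hB0
      have h2 : B * (1 / (2 * (B + 1)) * K) ≤ K / 2 := by
        rw [show B * (1 / (2 * (B + 1)) * K) = (B / (B + 1)) * (K / 2) by field_simp]
        have : B / (B + 1) ≤ 1 := by rw [div_le_one (by linarith)]; linarith
        nlinarith
      linarith
    linarith
  -- (3) congruence of every minimiser to `Pr`
  have hcong : ∀ Q : PeriodicConfiguration 1,
      (∀ Q' : PeriodicConfiguration 1, Q.energyPerParticle lennardJones ≤ Q'.energyPerParticle lennardJones) →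
      ∀ q₀ ∈ Q.points, ∃ A : EuclideanSpace ℝ (Fin 1) →ₗᵢ[ℝ] EuclideanSpace ℝ (Fin 1), Q.points = (fun p => q₀ + A p) '' Pr.points :=
    fun Q hQ q₀ hq₀ => stub_exactOfGood1D Pr Q q₀ hq₀ (key Q hQ q₀ hq₀)
  -- (4) identify `Pr.points` through the explicit chain `Pa` at its site `0`
  have h0 : (0 : EuclideanSpace ℝ (Fin 1)) ∈ Pa.points := by
    rw [hPapts]
    exact ⟨0, by simp⟩
  obtain ⟨A₀, hA₀⟩ := hcong Pa hmin 0 h0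
  have hrank : Module.finrank ℝ (EuclideanSpace ℝ (Fin 1)) = Module.finrank ℝ (EuclideanSpace ℝ (Fin 1)) := rfl
  set A₀e : EuclideanSpace ℝ (Fin 1) ≃ₗᵢ[ℝ] EuclideanSpace ℝ (Fin 1) := A₀.toLinearIsometryEquiv hrank with hA₀e
  have hA₀e_apply : ∀ p, A₀e p = A₀ p := fun p => rfl
  have hPr : Pr.points = Set.range (fun k : ℤ => EuclideanSpace.single (0 : Fin 1) ((k : ℝ) * a)) := by
    -- `Pr.points = A₀⁻¹(Pa.points) = 0 + A₀⁻¹(aℤe₀) = aℤe₀`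
    have h1 : Pr.points = (fun p => (0 : EuclideanSpace ℝ (Fin 1)) + A₀e.symm.toLinearIsometry p) '' Pa.points := by
      ext p
      simp only [zero_add, Set.mem_image, LinearIsometryEquiv.coe_toLinearIsometry]
      constructor
      · intro hp
        refine ⟨A₀ p, ?_, ?_⟩
        · rw [hA₀]; exact ⟨p, hp, by simp⟩
        · rw [← hA₀e_apply, LinearIsometryEquiv.symm_apply_apply]
      · rintro ⟨z, hz, rfl⟩
        rw [hA₀] at hz
        obtain ⟨p', hp', rfl⟩ := hz
        simpa only [zero_add, ← hA₀e_apply, LinearIsometryEquiv.symm_apply_apply] using hp'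
    rw [h1, hPapts, stub_isometryChain1D a 0 A₀e.symm.toLinearIsometry]
    simp only [zero_add]
  -- (5) conclude
  refine ⟨a, ha, ⟨Pa, hPapts, hmin⟩, fun Q hQ q hq => ?_⟩
  obtain ⟨A, hAQ⟩ := hcong Q hQ q hq
  rw [hAQ, hPr, stub_isometryChain1D a q A]

end Summit.AtomisticToContinuum.Crystallization.Cruxes.ExactCertificate.Transfer1D

end
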